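import Literature.MathematicalPhysics.QuantumFieldTheory.Balaban1983to89.B13NodeTorusWalksAccretive
import Literature.MathematicalPhysics.QuantumFieldTheory.Balaban1983to89.B13NodeTorusWalksGammaForm

/-!
# `Balaban1983to89.B13NodeTorusWalksGammaLeaves` — N10's WALKS LEAVES WITHOUT NODE A's FORM BOUND `hΓq` (₃ editions of
# `b13Leaf_twoTorus_walks₂` ∕ `b13Leaf_twoTorus_uniformWalksAcross₂`; `g_q` the package number of `B13NodeTorusWalksGammaForm`)

statement-level bookkeeping over published theorems with citation tags; kernel-checked compositions of tree theorems; nothing here is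
a claim about the Yang–Mills mass gap.

Cell `pub-ymgap`, D-0062 Track A, node N10 = [Balaban1988RG2Cluster] Lemmas 1–3; seat `dag-n10-c` (FAN-OUT §N10 s3), module 8 — the
GENERIC companions of the record-level ₃ edition `N10AtRecord11B13WalksGamma.b13LeafOfRecord_of_located_walks₃` (p463177).

WHAT.  Exactly `B13NodeTorusWalksAccretive.b13Leaf_twoTorus_walks₂` resp. `…uniformWalksAcross₂` (p453901; same binders in the same
order, same conclusion `Lemma1Printed ∧ Lemma2Printed ∧ Lemma3Printed` for `Wt.toStepData`) except that NODE A's structural input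
`hΓq : ∀ Z t X, (Γ₀X)·C(Γ₀X) ≤ g_q|X|²` and its sign `hgq` are REMOVED — supplied per term by
`B13NodeTorusWalksGammaForm.gammaForm_le_of_termWalks` (p462991) from the rung, the fibre letter `hfibΛ` and the torus dimension `ν` —,
the sign binder `hη0 : 0 < q.η` is ADDED (and, for the rate-book leaf `…walks₃`, `hp : q.PositiveRates`, `hη : q.η ≤ q.etaMax`, which
the form bound reads), and the letter `g_q` inside `hsmall` ∕ `hvol` is the displayed number `(q.BΓ·q.cV)·(q.BΓ·(m·c₀(1,q.η)^ν)) ∕ q.mA`.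
After p453901 (`hA`, `hcE`) this reads the third of NODE A's structural inputs off the rung.  What REMAINS by assertion: the rung for
Bałaban's kernels (NODE A ∕ N06; NOT supplied), complex symmetry `hAs`, `hlin` (definitional), separate holomorphy, termwise domination
`hH`, the in-edges (1.24)∕(1.30), identifications, numbers.
* `b13Leaf_twoTorus_walks₃` (per-term `TermWalks`, any rate book + the standard-rate-book side conditions for the form bound),
  `b13Leaf_twoTorus_uniformWalksAcross₃` (the FAN-OUT s3 shape: `UniformWalksAcross 𝓣 q` + print's two thresholds).

CITATIONS.  [Balaban1988RG2Cluster] Lemmas 1–3 pp. 9, 11, 20; p. 13, p. 15, (2.14)–(2.26) pp. 15–17.  [Balaban1985BackgroundPropagators]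
Thm 3.10 p. 416.  [Balaban1984PropagatorsII] Lemma 2.1 (2.61) p. 234.

HONEST FRAMING: count-neutral Track-A side landing; N10 NOT discharged; nothing of Bałaban's asserted; nothing continuum ∕ ℝ⁴ ∕ OS ∕
mass-gap ∕ Clay.  0 `sorry`, 0 `def`, standard axioms.
-/

noncomputable section

namespace Literature.MathematicalPhysics.QuantumFieldTheory.Balaban1983to89.B13NodeTorusWalksGammaLeaves

open Metric Set
open Literature.MathematicalPhysics.QuantumFieldTheory.Balaban1983to89
open Literature.MathematicalPhysics.QuantumFieldTheory.Balaban1983to89.B16Absorption (pbox)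
open Literature.MathematicalPhysics.QuantumFieldTheory.Balaban1983to89.TreeLengthTorus
open Literature.MathematicalPhysics.QuantumFieldTheory.Balaban1983to89.TreeLengthTorusGeometry
open Literature.MathematicalPhysics.QuantumFieldTheory.Balaban1983to89.TreeLengthTorusTransfer
open Literature.MathematicalPhysics.QuantumFieldTheory.Balaban1983to89.B12TreeDecay (kappa₀ K₀)
open Literature.MathematicalPhysics.QuantumFieldTheory.Balaban1983to89.B13Lemma3TorusData
open Literature.MathematicalPhysics.QuantumFieldTheory.Balaban1983to89.B13Lemma3Torus (TwoTorusStep)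
open Literature.MathematicalPhysics.QuantumFieldTheory.Balaban1983to89.B13Lemma3TorusSocket (Lemma3Numerics)
open Literature.MathematicalPhysics.QuantumFieldTheory.Balaban1983to89.B13PkScaling (Qop scaled)
open Literature.MathematicalPhysics.QuantumFieldTheory.Balaban1983to89.DagBinding
open Literature.MathematicalPhysics.QuantumFieldTheory.Balaban1983to89.B13Bound143 (invTau R12)
open Literature.MathematicalPhysics.QuantumFieldTheory.Balaban1983to89.B13Term214 (term214 SepHolOn core214 F214)
open Literature.MathematicalPhysics.QuantumFieldTheory.Balaban1983to89.B13Lemma3TorusTerms (terms weight Z0)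
open Literature.MathematicalPhysics.QuantumFieldTheory.Balaban1983to89.B5TorusCover (UT)
open Literature.MathematicalPhysics.QuantumFieldTheory.Balaban1983to89.B9Thm37GlueTorus (tdist1)
open Literature.MathematicalPhysics.QuantumFieldTheory.Balaban1983to89.B13TermWalkData (TermKernels TorusTerms)
open Literature.MathematicalPhysics.QuantumFieldTheory.Balaban1983to89.NodeOLettersOfWalksAcross
  (WalkPackage RateBook TermWalks UniformWalksAcross)
open Literature.MathematicalPhysics.QuantumFieldTheory.Balaban1983to89.NodeOLettersOfWalksPerturbative (RefPackage)
open Literature.MathematicalPhysics.QuantumFieldTheory.Balaban1983to89.B13NodeTorusWalks (termWalks_of_uniformWalksAcross)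
open Literature.MathematicalPhysics.QuantumFieldTheory.Balaban1983to89.B13NodeTorusWalksAccretive
  (b13Leaf_twoTorus_walks₂ b13Leaf_twoTorus_uniformWalksAcross₂)
open Literature.MathematicalPhysics.QuantumFieldTheory.Balaban1983to89.B13NodeTorusWalksGammaForm (gammaForm_le_of_termWalks)

/-! ## §1. The per-term walks leaf, `hΓq` derived -/

section Walks

variable {L N' : ℕ} [NeZero L] [NeZero N']

open Matrix

open Classical in
/-- **N10's LEAF TRIPLE ON THE TWO-SCALE TORUS FROM THE W-WALKS RUNG — `hΓq` NO LONGER ASKED.**  Exactly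
`B13NodeTorusWalksAccretive.b13Leaf_twoTorus_walks₂` except: NODE A's form bound `hΓq` and its sign `hgq` REMOVED (derived per term
by `gammaForm_le_of_termWalks` from `hwalks`, `hfibΛ`, `ν`), binders `hp`, `hη`, `hη0` ADDED after `hq` (the form bound reads the
standard rate book's `ρ′ = μ∕4 ≥ η > 0`), and `g_q := (q.BΓ·q.cV)·(q.BΓ·(m·c₀(1,q.η)^ν)) ∕ q.mA` displayed inside `hsmall` ∕ `hvol`.
[cite: Balaban1988RG2Cluster, Lemmas 1–3 pp.9, 11, 20; p.13, p.15, (2.14)–(2.26) pp.15–17; Balaban1985BackgroundPropagators, Thm 3.10 p.416] -/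
theorem b13Leaf_twoTorus_walks₃
    (Wt : TwoTorusStep 4 L N') (c : B13.Consts) (k : ℕ) (hN12 : 12 ≤ L * N') (hL8 : 8 ≤ c.L) (hLc : c.L = L)
    -- (1) LEMMA 1: index data of (1.33)
    (S0 : TDom 4 (L * N') → Finset (TPt 4 (L * N')))
    (F : TDom 4 (L * N') → TPt 4 (L * N') → Finset (TPt 4 (L * N')))
    (Sq : TDom 4 (L * N') → TPt 4 (L * N') → (j : ℕ) → Finset (TPt 4 (L ^ (k - j) * (L * N'))))
    (SX : TDom 4 (L * N') → TPt 4 (L * N') → (j : ℕ) → TPt 4 (L ^ (k - j) * (L * N')) →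
      Finset (TDom 4 (L ^ (k - j) * (L * N'))))
    (T : TDom 4 (L * N') → TPt 4 (L * N') → Finset (TPt 4 (L * N')) → (j : ℕ) →
      TPt 4 (L ^ (k - j) * (L * N')) → TDom 4 (L ^ (k - j) * (L * N')) → Wt.Φ → ℂ)
    (Sc : TDom 4 (L * N') → Finset (TPt 4 (L * N')))
    (Sq' : TDom 4 (L * N') → TPt 4 (L * N') → (j : ℕ) → Finset (TPt 4 (L ^ (k - j) * (L * N'))))
    (SX' : TDom 4 (L * N') → TPt 4 (L * N') → (j : ℕ) → TPt 4 (L ^ (k - j) * (L * N')) →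
      Finset (TDom 4 (L ^ (k - j) * (L * N'))))
    (T' : TDom 4 (L * N') → TPt 4 (L * N') → (j : ℕ) → TPt 4 (L ^ (k - j) * (L * N')) →
      TDom 4 (L ^ (k - j) * (L * N')) → Wt.Φ → ℂ)
    (dist : TDom 4 (L * N') → TPt 4 (L * N') → (j : ℕ) → TPt 4 (L ^ (k - j) * (L * N')) → ℝ) {K K' : ℝ}
    (h133 : ∀ Y, Wt.Vp Y =
      (∑ a ∈ S0 Y, ∑ X ∈ (F Y a).powerset, ∑ j ∈ Finset.range (k + 1), ∑ q ∈ Sq Y a j,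
        ∑ x ∈ SX Y a j q, T Y a X j q x) +
      (∑ a ∈ Sc Y, ∑ j ∈ Finset.range (k + 1), ∑ q ∈ Sq' Y a j, ∑ x ∈ SX' Y a j q, T' Y a j q x))
    (hS0Y : ∀ Y, ∀ a ∈ S0 Y,
      (pbox (fun i => natLift a i - (5 : ℕ)) (fun i => natLift a i + 1 + (5 : ℕ))).image (proj (L * N')) ⊆ Y.1)
    (hFsub : ∀ Y a, F Y a ⊆
      (pbox (fun i => natLift a i - (5 : ℕ)) (fun i => natLift a i + 1 + (5 : ℕ))).image (proj (L * N')) \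
        (pbox (fun i => natLift a i - (4 : ℕ)) (fun i => natLift a i + 1 + (4 : ℕ))).image (proj (L * N')))
    (hSq : ∀ Y, ∀ a ∈ S0 Y, ∀ j, Sq Y a j ⊆ (Finset.univ : Finset (TPt 4 (L ^ (k - j) * (L * N')))).filter
      (fun q => tcoarse (L ^ (k - j)) (L * N') q ∈
        (pbox (fun i => natLift a i - (2 : ℕ)) (fun i => natLift a i + 1 + (2 : ℕ))).image (proj (L * N'))))
    (hScY : ∀ Y, Sc Y ⊆ Y.1)
    (hdist0 : ∀ Y a j q, 0 ≤ c.δ₀ * dist Y a j q)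
    (hdist : ∀ Y a j (n : ℕ) q, q ∉ (pbox (fun i => ((L ^ (k - j) : ℕ) : ℤ) * natLift a i - (n + 1 : ℕ))
      (fun i => ((L ^ (k - j) : ℕ) : ℤ) * natLift a i + 2 * ((L ^ (k - j) : ℕ) : ℤ) - 1 + (n + 1 : ℕ))).image
        (proj (L ^ (k - j) * (L * N'))) → c.δ₀ * c.M * ((n : ℝ) + 1) ≤ c.δ₀ * dist Y a j q)
    (hSX : ∀ Y a j q, SX Y a j q ⊆ (tcubeSys 4 (L ^ (k - j) * (L * N'))).above q)
    (hSX' : ∀ Y a j q, SX' Y a j q ⊆ (tcubeSys 4 (L ^ (k - j) * (L * N'))).above q)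
    (hX0 : ∀ Y, ∀ a ∈ Sc Y, ∀ j ∈ Finset.range (k + 1), ∀ q ∈ Sq' Y a j, ∀ x ∈ SX' Y a j q,
      x.1.image (tcoarse (L ^ (k - j)) (L * N')) ⊆ Y.1)
    -- (1) LEMMA 1: analyticity of the terms, closure of `Analytic`
    (hAdd : ∀ (s : Set Wt.Φ) (f g : Wt.Φ → ℂ), Wt.Analytic f s → Wt.Analytic g s → Wt.Analytic (f + g) s)
    (hZero : ∀ s : Set Wt.Φ, Wt.Analytic 0 s)
    (hAnT : ∀ Y, ∀ a ∈ S0 Y, ∀ X ∈ (F Y a).powerset, ∀ j ∈ Finset.range (k + 1), ∀ q ∈ Sq Y a j,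
      ∀ x ∈ SX Y a j q, Wt.Analytic (T Y a X j q x) (Wt.sp1 Y))
    (hAnT' : ∀ Y, ∀ a ∈ Sc Y, ∀ j ∈ Finset.range (k + 1), ∀ q ∈ Sq' Y a j, ∀ x ∈ SX' Y a j q,
      Wt.Analytic (T' Y a j q x) (Wt.sp1 Y))
    -- (1) LEMMA 1: thresholds and restrictions
    (hK : 0 ≤ K) (hK' : 0 ≤ K') (hκ : 0 ≤ c.κ) (hδ1 : c.δ < 1) (hδκ : 1 ≤ c.δ * c.κ)
    (hκ126 : kappa₀ 64 8 ≤ c.κ) (hκ126' : kappa₀ 64 8 ≤ c.δ * c.κ)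
    (hκ₁ : 1 + 2 * Real.log (8 * 12 ^ 3) ≤ c.κ₁) (hκ₁' : 2 + 16 * Real.log 128 ≤ c.κ₁)
    (hδ₀M : 10 * Real.exp (-1) ≤ c.δ₀ * c.M) (hδ₀M5 : 2 * Real.log 5 ≤ c.δ₀ * c.M)
    (hR8 : (1 - c.δ) * c.κ ≤ (1 / 4) * (c.κ₁ - 1)) (hR9 : (1 - 2 * c.δ) * c.κ ≤ (1 / 16) * c.κ₁)
    -- (1) LEMMA 1: per-term (1.24), (1.30) (IN-EDGES); the constants of (1.36) with headroom (1 − θ) for the local pieces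
    (h124 : ∀ Y φ, φ ∈ Wt.sp1 Y → ∀ a ∈ S0 Y, ∀ X ∈ (F Y a).powerset, ∀ j ∈ Finset.range (k + 1), ∀ q ∈ Sq Y a j,
      ∀ x ∈ SX Y a j q,
        ‖T Y a X j q x φ‖ ≤ K * ((L : ℝ) ^ j * ((L : ℝ) ^ k)⁻¹) ^ 5 *
          Real.exp (-(c.κ₁ - 1) *
            (((Y.1 \ (pbox (fun i => natLift a i - (5 : ℕ)) (fun i => natLift a i + 1 + (5 : ℕ))).image
              (proj (L * N'))).card : ℝ) + X.card)) *
          Real.exp (-(c.κ * torusTreeLen x.1)))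
    (h130 : ∀ Y φ, φ ∈ Wt.sp1 Y → ∀ a ∈ Sc Y, ∀ j ∈ Finset.range (k + 1), ∀ q ∈ Sq' Y a j,
      ∀ x ∈ SX' Y a j q,
        ‖T' Y a j q x φ‖ ≤ K' * Real.exp (-(1 / 2) * (c.δ₀ * c.M) * ((L : ℝ) ^ j * ((L : ℝ) ^ k)⁻¹)⁻¹
            - (1 / 2) * c.δ₀ * dist Y a j q) *
          Real.exp (-(c.κ₁ - 1) * ((Y.1 \ x.1.image (tcoarse (L ^ (k - j)) (L * N'))).card : ℝ)) *
          Real.exp (-(c.κ * torusTreeLen x.1)))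
    {θ : ℝ} (hθ0 : 0 ≤ θ) (hθ1 : θ < 1)
    (hC : K * K₀ 64 8 * (2 * (6 * (L : ℝ)) ^ 4) * Real.exp 1 * Real.exp ((1 / 8) * c.κ₁ * (12 ^ 4 - 1)) +
        2 * (64 * K') * K₀ 64 8 * 1344 ≤
      (1 - θ) * (c.E₀ * c.ε₁ * c.C₁ * c.M ^ c.q * Real.exp (c.C₂ * c.κ₁)))
    -- (2) LEMMA 2 (pp. 10–11): V″_k = V′_k + the local pieces G of P^{(k)}, analytic and (1.36)-small at prefactor θ
    (Gl : TDom 4 (L * N') → Wt.Φ → ℂ) (hVpp : ∀ Y, Wt.Vpp Y = fun φ => Wt.Vp Y φ + Gl Y φ)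
    (hGlAn : ∀ Y, Wt.Analytic (Gl Y) (Wt.sp1 Y))
    (hGl : ∀ Y φ, φ ∈ Wt.sp1 Y → ‖Gl Y φ‖ ≤ θ * (c.E₀ * c.ε₁ * c.C₁ * c.M ^ c.q * Real.exp (c.C₂ * c.κ₁)) *
      Real.exp (-((1 - 2 * c.δ) * c.κ * (tsys 4 (L * N')).dj Y)))
    -- (2) LEMMA 2: the located per-term data of `B13Lemma2Torus.lemma2Printed_twoTorus'`
    {E : Type*} [NormedAddCommGroup E] [NormedSpace ℂ E]
    (rd : TDom 4 (L * N') → Wt.Φ → E) (e : TDom 4 (L * N') → Wt.Bond → E) (he : ∀ Y b, ‖e Y b‖ ≤ 1)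
    (hrd : ∀ Y φ, rd Y φ = haveI := Wt.finBond; ∑ b, Wt.Bv φ b • e Y b)
    {ι₂ : Type*} (s : TDom 4 (L * N') → Finset ι₂) (Wf : TDom 4 (L * N') → ι₂ → Wt.Φ → E → ℂ) {g : ℂ} (hg : g ≠ 0)
    {R K₂ : ℝ} {m₂ : ℕ} (hK₂ : 0 ≤ K₂) (hR : 0 < R) (h3 : 3 * c.ε₁ ≤ R)
    (hW : ∀ Y, ∀ i ∈ s Y, ∀ φ ∈ Wt.sp1 Y, AnalyticOnNhd ℂ (Wf Y i φ) (ball 0 R))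
    (hKW : ∀ Y, ∀ i ∈ s Y, ∀ φ ∈ Wt.sp1 Y, ∀ z ∈ ball (0 : E) R,
      ‖Wf Y i φ z‖ ≤ K₂ * Real.exp (-(c.κ₁ - 1) * ((Y.1.card : ℝ) - 1)) * ‖z‖ ^ 3)
    (hcard : ∀ Y, (s Y).card ≤ m₂ * Y.1.card)
    (hV : ∀ Y, Wt.V Y = fun φ => (∑ i ∈ s Y, scaled g (Wf Y i φ) (rd Y φ)) + Wt.Vpp Y φ)
    (hQ : ∀ Y φ (b b' : Wt.Bond), φ ∈ Wt.sp1 Y →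
      Wt.Q Y φ b b' = 2 * ∑ i ∈ s Y, Qop (scaled g (Wf Y i φ)) (rd Y φ) (e Y b) (e Y b'))
    (hsp : ∀ Y φ, φ ∈ Wt.sp1 Y → ‖g‖ * ‖rd Y φ‖ < c.ε₁)
    (hvolk : ∀ Y, Wt.volk Y = Y.1.card)
    (hfloor : 27 * m₂ * K₂ * Real.exp (c.κ₁ - 1) ≤ c.C₃ * c.M ^ 4 * Real.exp (c.C₂ * c.κ₁))
    (hAnP : ∀ Y, ∀ i ∈ s Y, Wt.Analytic (fun φ => scaled g (Wf Y i φ) (rd Y φ)) (Wt.sp1 Y))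
    (hG : ∀ Y, Wt.GaugeInv (Wt.V Y) ∧ Wt.GaugeInv (Wt.toStepData.quadForm Y) ∧ Wt.GaugeInv (Wt.Vpp Y))
    -- (3) LEMMA 3 (pp. 14–20): the signs of (2.18)–(2.20), R12, |τ(Y)| ≥ 2, and the numerics bundle at ℓ = ½L
    (M₃ : ℕ) [NeZero M₃] {a a₂ a₂' a₅ Aabs : ℝ} (hN : Lemma3Numerics c M₃ ((c.L : ℝ) / 2) a a₂ a₂' a₅ Aabs)
    (h12 : R12 c) (hE : 0 < c.E₀) (hε : 0 < c.ε₁) (hC₁ : 0 < c.C₁) (hα : 0 < c.α₄) (hM : 1 ≤ c.M)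
    (hτ2 : c.E₀ * c.ε₁ * c.C₁ * c.α₄⁻¹ * c.M ^ c.q * Real.exp (c.C₂ * c.κ₁) ≤ 1 / 2)
    -- (3) the Cauchy radius and the parameter domains (p. 15)
    {Uσ Uτ : Set ℂ} (hUσ : IsOpen Uσ) (hUτ : IsOpen Uτ) (hUexp : Metric.closedBall (0 : ℂ) (Real.exp c.κ₁) ⊆ Uσ)
    (hUtau : ∀ Y : TDom 4 (L * N'), Metric.closedBall (0 : ℂ) ((invTau c ((tsys 4 (L * N')).dj Y))⁻¹) ⊆ Uτ)
    {r : ℝ} (hr : 0 < r) (hr' : r ≤ Real.exp c.κ₁ - 1)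
    (hsubτ : ∀ x ∈ Set.uIcc (0 : ℝ) 1, Metric.closedBall (x : ℂ) r ⊆ Uτ)
    -- (3) THE DICTIONARY: per term (𝐃, P) of every Z ∈ 𝐃_{k+1}, the kernel data `𝒦 Z t` on a site torus `UT Nf` with
    --     configuration space `E₃`, and the configuration `u = uOf Z t φ` of `φ ∈ sp2 Z`, of size ≤ α
    {ν : ℕ} {Nf : Fin ν → ℕ} [∀ i, NeZero (Nf i)]
    {E₃ : Type*} [NormedAddCommGroup E₃] [NormedSpace ℂ E₃]
    (𝒦 : TDom 4 N' → Finset (TDom 4 (L * N')) × Finset (TBond 4 M₃ (L * N')) → TermKernels c 4 N' ν Nf E₃)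
    [∀ Z t, Fintype (𝒦 Z t).C₀] [∀ Z t, DecidableEq (𝒦 Z t).C₀]
    (uOf : (Z : TDom 4 N') → (t : Finset (TDom 4 (L * N')) × Finset (TBond 4 M₃ (L * N'))) → Wt.Φ → E₃)
    {α : ℝ} (hαnn : 0 ≤ α) (huα : ∀ Z, ∀ t ∈ terms L M₃ Z, ∀ φ ∈ Wt.sp2 Z, ‖uOf Z t φ‖ ≤ α)
    -- (3) per term: parameter lists, the linear map Γ(σ), characteristic functions, potentials
    (lZ : TDom 4 N' → Finset (TDom 4 (L * N')) × Finset (TBond 4 M₃ (L * N')) → List (TPt 4 N'))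
    (hlZ : ∀ Z, ∀ t ∈ terms L M₃ Z, (lZ Z t).Nodup ∧ (lZ Z t).toFinset = Z.1 \ tclosure L N' (Z0 M₃ t))
    (lD : TDom 4 N' → Finset (TDom 4 (L * N')) × Finset (TBond 4 M₃ (L * N')) → List (TDom 4 (L * N')))
    (hlD : ∀ Z, ∀ t ∈ terms L M₃ Z, (lD Z t).Nodup ∧ (lD Z t).toFinset = t.1)
    (Γm : (Z : TDom 4 N') → (t : Finset (TDom 4 (L * N')) × Finset (TBond 4 M₃ (L * N'))) → Wt.Φ →
      (TPt 4 N' → ℂ) → ((𝒦 Z t).Λ ⊕ (𝒦 Z t).C₀ → ℝ) → ((𝒦 Z t).Λ → ℂ))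
    (χY₀ χcP : (Z : TDom 4 N') → (t : Finset (TDom 4 (L * N')) × Finset (TBond 4 M₃ (L * N'))) →
      ((𝒦 Z t).Λ → ℝ) → ℝ)
    (hχ0 : ∀ Z t B, 0 ≤ χY₀ Z t B) (hχ1 : ∀ Z t B, χY₀ Z t B ≤ 1)
    (Pl : (Z : TDom 4 N') → (t : Finset (TDom 4 (L * N')) × Finset (TBond 4 M₃ (L * N'))) → Finset (𝒦 Z t).Λ)
    (hPcard : ∀ Z, ∀ t ∈ terms L M₃ Z, (Pl Z t).card = t.2.card) {rP : ℝ} (hrP : 0 ≤ rP)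
    (hχc : ∀ Z t B, χcP Z t B = ∏ b ∈ Pl Z t, (if rP ≤ |B b| then (1 : ℝ) else 0))
    (Dfam : TDom 4 N' → Finset (TDom 4 (L * N')) × Finset (TBond 4 M₃ (L * N')) → Finset (TDom 4 (L * N')))
    (Vr : (Z : TDom 4 N') → (t : Finset (TDom 4 (L * N')) × Finset (TBond 4 M₃ (L * N'))) → Wt.Φ →
      TDom 4 (L * N') → ((𝒦 Z t).Λ → ℝ) → ℂ)
    -- (3) termwise domination: ‖H(Z)‖ ≤ Σ_{(𝐃,P)} ‖(2.14)‖ on the space of p. 15 ((2.9)/(2.14))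
    (hH : ∀ (Z : TDom 4 N') (φ : Wt.Φ), φ ∈ Wt.sp2 Z → ‖Wt.H Z φ‖ ≤
      ∑ t ∈ terms L M₃ Z, ‖term214 r (lZ Z t) (lD Z t)
        (core214 (fun σ => (𝒦 Z t).A2 σ (uOf Z t φ)) (Γm Z t φ)
          (F214 t.2.card (χY₀ Z t) (χcP Z t) (Dfam Z t) (Vr Z t φ))) 0 0‖)
    -- (3) the record's objects behind the terms: bonds, cubes, the real field inside the configurations
    (ιb : (Z : TDom 4 N') → (t : Finset (TDom 4 (L * N')) × Finset (TBond 4 M₃ (L * N'))) → (𝒦 Z t).Λ → Wt.Bond)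
    (hι : ∀ Z t, Function.Injective (ιb Z t)) (cube : Wt.Bond → TPt 4 (L * N'))
    (hQsupp : ∀ (Y : TDom 4 (L * N')) φ b b', Wt.Q Y φ b b' ≠ 0 → cube b ∈ Y.1 ∧ cube b' ∈ Y.1)
    {m' : ℕ} (hfibc : ∀ Z t (x : TPt 4 (L * N')), (Finset.univ.filter fun j => cube (ιb Z t j) = x).card ≤ m')
    (emb : (Z : TDom 4 N') → (t : Finset (TDom 4 (L * N')) × Finset (TBond 4 M₃ (L * N'))) → Wt.Φ →
      ((𝒦 Z t).Λ → ℝ) → Wt.Φ)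
    (hBv : ∀ Z t φ B b, Wt.Bv (emb Z t φ B) (ιb Z t b) = (B b : ℂ))
    (hBv0 : ∀ Z t φ B b', b' ∉ Set.range (ιb Z t) → Wt.Bv (emb Z t φ B) b' = 0)
    (hVr : ∀ Z, ∀ t ∈ terms L M₃ Z, ∀ φ ∈ Wt.sp2 Z, ∀ Y ∈ Dfam Z t, ∀ B,
      emb Z t φ B ∈ Wt.sp1 Y → Vr Z t φ Y B = Wt.V Y (emb Z t φ B))
    (hχsupp : ∀ Z, ∀ t ∈ terms L M₃ Z, ∀ φ ∈ Wt.sp2 Z, ∀ B, χY₀ Z t B ≠ 0 → ∀ Y ∈ Dfam Z t,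
      emb Z t φ B ∈ Wt.sp1 Y)
    -- (3) separate holomorphy of the X-integral in (σ, τ)
    (hΨσ : ∀ Z, ∀ t ∈ terms L M₃ Z, ∀ φ ∈ Wt.sp2 Z, ∀ τ : TDom 4 (L * N') → ℂ, (∀ j, τ j ∈ Uτ) →
      SepHolOn Uσ (fun σ => core214 (fun σ => (𝒦 Z t).A2 σ (uOf Z t φ)) (Γm Z t φ)
        (F214 t.2.card (χY₀ Z t) (χcP Z t) (Dfam Z t) (Vr Z t φ)) σ τ))
    (hΨτ : ∀ Z, ∀ t ∈ terms L M₃ Z, ∀ φ ∈ Wt.sp2 Z, ∀ σ : TPt 4 N' → ℂ, (∀ j, σ j ∈ Uσ) →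
      SepHolOn Uτ (fun τ => core214 (fun σ => (𝒦 Z t).A2 σ (uOf Z t φ)) (Γm Z t φ)
        (F214 t.2.card (χY₀ Z t) (χcP Z t) (Dfam Z t) (Vr Z t φ)) σ τ))
    -- (3) NODE A's structural inputs at the configuration: A(σ) COMPLEX SYMMETRIC on the polydisc; Γ(σ) = G(σ)·
    --     (`Re A(σ) ≻ 0` is no longer asked: it follows from the rung's m_A-accretivity, `re_posDef_of_termWalks`)
    (hAs : ∀ Z, ∀ t ∈ terms L M₃ Z, ∀ φ ∈ Wt.sp2 Z, ∀ σ : TPt 4 N' → ℂ, (∀ j, ‖σ j‖ ≤ Real.exp c.κ₁) →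
      ((𝒦 Z t).A2 σ (uOf Z t φ)).IsSymm)
    (hlin : ∀ Z, ∀ t ∈ terms L M₃ Z, ∀ φ ∈ Wt.sp2 Z, ∀ σ : TPt 4 N' → ℂ, (∀ j, ‖σ j‖ ≤ Real.exp c.κ₁) →
      ∀ X : (𝒦 Z t).Λ ⊕ (𝒦 Z t).C₀ → ℝ, Γm Z t φ σ X = (𝒦 Z t).G2 σ (uOf Z t φ) *ᵥ fun j => (X j : ℂ))
    {γ₂ : ℝ} (hγ₂ : 0 ≤ γ₂)
    -- (3) uniform fibre bounds of the bond locations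
    {m : ℕ}
    (hfibΛ : ∀ Z t (x : UT Nf), (Finset.univ.filter fun i => (𝒦 Z t).locΛ i = x).card ≤ m)
    (hfibN : ∀ Z t (x : UT Nf), (Finset.univ.filter fun j => (𝒦 Z t).locN j = x).card ≤ m)
    -- (3) THE W-WALKS RUNG ON THE TERMS OF THE STEP (the displayed hypothesis): ONE package, a rate book, round letters
    (q : WalkPackage) (hq : q.Admissible) (hp : q.PositiveRates) (hη : q.η ≤ q.etaMax) (hη0 : 0 < q.η)
    (rb : RateBook q) (hκC : 0 < rb.κC) (hκCρ : rb.κC ≤ rb.ρ') (hαR : α < q.R)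
    (hwalks : ∀ Z, ∀ t ∈ terms L M₃ Z, TermWalks (𝒦 Z t) q)
    {KG KCs θ₀ : ℝ} (hKG : q.Kbar ≤ KG) (hKCs : 4 / q.mA ≤ KCs)
    (hθ : 2 * q.Kbar * (Real.exp (-((rb.ρ' - rb.κC) * q.Rσ)) + α / q.R) ≤ θ₀)
    -- (3) rates below the rung's κ_C, and NODE A's letter ϑ (θ_Γ = θ_E = θ₀, K_Γ = K_G, K₀′ = K_Cs, θ_C derived)
    {kap kap' kap'' kap₂ ϑ : ℝ} (hkap'' : 0 < kap'') (hk1 : kap'' < kap') (hk2 : kap' < kap) (hk3 : kap < kap₂)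
    (hk4 : kap₂ < rb.κC) (hθ₀le : θ₀ ≤ ϑ)
    (hθR1le : (m * (1 + 2 / (kap - kap')) ^ ν) * (m * (1 + 2 / (kap' - kap'')) ^ ν)
      * (θ₀ * KCs * KG
        + KG * (KCs * θ₀ * (m * (1 + 2 / (rb.κC - kap₂)) ^ ν) * KCs * (m * (1 + 2 / (kap₂ - kap)) ^ ν)) * KG
        + KG * KCs * θ₀) ≤ ϑ)
    (hsmallKθ : KCs * (m * (1 + 2 / kap) ^ ν) * (ϑ * (m * (1 + 2 / kap'') ^ ν)) < 1)
    -- (3) the (2.24)–(2.25) smallness with `a₂₀ = m′·α₄·M⁻⁴(1 + 32/(κ₁−1))⁴`; the eigenvalue bound of C is the NUMBER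
    --     `1∕m_A ≤ cE`; the form bound of Γ₀ is the NUMBER `g_q = B_Γ²c_V·m c₀(1,η)^ν∕m_A` (`gammaForm_le_of_termWalks`)
    {cE : ℝ} (hc0 : 0 ≤ cE)
    (hcE : 1 / q.mA ≤ cE)
    (hαc : (2 * (ϑ * (m * (1 + 2 / kap'') ^ ν)) +
      (γ₂ + m' * c.α₄ * (c.M ^ 4)⁻¹ * (1 + 32 / (c.κ₁ - 1)) ^ 4)) * cE ≤ 1 / 2)
    (hsmall : (2 * (ϑ * (m * (1 + 2 / kap'') ^ ν)) +
      (γ₂ + m' * c.α₄ * (c.M ^ 4)⁻¹ * (1 + 32 / (c.κ₁ - 1)) ^ 4)) * (1 + 2 * cE * ((q.BΓ * q.cV) * (q.BΓ * (m * B6.c0 1 q.η ^ ν)) / q.mA)) ≤ 1 / 2)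
    -- (3) constant matching, p. 17: `a ≤ γ₂ r_P²` and the volume factor with `w = K₀(64,8)·α₄·#(⋃𝐃)`
    (hPa : a ≤ γ₂ * rP ^ 2)
    (hvol : ∀ Z, ∀ t ∈ terms L M₃ Z,
      2 * (KCs * (m * (1 + 2 / kap) ^ ν) * (ϑ * (m * (1 + 2 / kap'') ^ ν))
              * (1 + (1 - KCs * (m * (1 + 2 / kap) ^ ν) * (ϑ * (m * (1 + 2 / kap'') ^ ν)))⁻¹) / 2)
          * (Fintype.card (𝒦 Z t).Λ : ℝ)
        + K₀ 64 8 * c.α₄ * ((((Dfam Z t).image Subtype.val).biUnion id).card : ℝ)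
        + (2 * (ϑ * (m * (1 + 2 / kap'') ^ ν)) +
            (γ₂ + m' * c.α₄ * (c.M ^ 4)⁻¹ * (1 + 32 / (c.κ₁ - 1)) ^ 4)) * cE * (Fintype.card (𝒦 Z t).Λ : ℝ)
        + (2 * (ϑ * (m * (1 + 2 / kap'') ^ ν)) +
            (γ₂ + m' * c.α₄ * (c.M ^ 4)⁻¹ * (1 + 32 / (c.κ₁ - 1)) ^ 4)) * (1 + 2 * cE * ((q.BΓ * q.cV) * (q.BΓ * (m * B6.c0 1 q.η ^ ν)) / q.mA))
            * (Fintype.card ((𝒦 Z t).Λ ⊕ (𝒦 Z t).C₀) : ℝ)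
        ≤ a₅ * ((Z.1).card : ℝ)) :
    B13.Lemma1Printed Wt.toStepData c ∧ B13.Lemma2Printed Wt.toStepData c ∧ B13.Lemma3Printed Wt.toStepData c :=
  b13Leaf_twoTorus_walks₂ Wt c k hN12 hL8 hLc S0 F Sq SX T Sc Sq' SX' T' dist h133 hS0Y hFsub hSq hScY hdist0 hdist
    hSX hSX' hX0 hAdd hZero hAnT hAnT' hK hK' hκ hδ1 hδκ hκ126 hκ126' hκ₁ hκ₁' hδ₀M hδ₀M5 hR8 hR9 h124 h130 hθ0 hθ1 hC
    Gl hVpp hGlAn hGl rd e he hrd s Wf hg hK₂ hR h3 hW hKW hcard hV hQ hsp hvolk hfloor hAnP hG M₃ hN h12 hE hε hC₁ hα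
    hM hτ2 hUσ hUτ hUexp hUtau hr hr' hsubτ 𝒦 uOf hαnn huα lZ hlZ lD hlD Γm χY₀ χcP hχ0 hχ1 Pl hPcard hrP hχc Dfam Vr
    hH ιb hι cube hQsupp hfibc emb hBv hBv0 hVr hχsupp hΨσ hΨτ hAs hlin hγ₂ hfibΛ hfibN q hq rb hκC hκCρ hαR hwalks
    hKG hKCs hθ hkap'' hk1 hk2 hk3 hk4 hθ₀le hθR1le hsmallKθ hc0 hcE hαc
    (div_nonneg (mul_nonneg (mul_nonneg (WalkPackage.BΓ_nonneg hq) hq.hcV)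
      (mul_nonneg (WalkPackage.BΓ_nonneg hq)
        (mul_nonneg (Nat.cast_nonneg m) (pow_nonneg (RefPackage.c0_nonneg hη0) ν)))) hq.hmA.le)
    (fun Z t ht X => gammaForm_le_of_termWalks hq hp hη hη0 (hwalks Z t ht) (hfibΛ Z t) le_rfl X)
    hsmall hPa hvol

end Walks

/-! ## §2. The FAN-OUT s3 shape, `hΓq` derived -/

section Across

variable {L : ℕ} [NeZero L]

open Matrix

open Classical in
/-- **N10's LEAF TRIPLE FROM THE DISPLAYED HYPOTHESIS `UniformWalksAcross 𝓣 q` — `hΓq` NO LONGER ASKED.**  Exactly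
`B13NodeTorusWalksAccretive.b13Leaf_twoTorus_uniformWalksAcross₂` except: `hΓq`, `hgq` REMOVED (derived per term by
`gammaForm_le_of_termWalks` at the member's term `idx Z t`, `termWalks_of_uniformWalksAcross`), `hη0 : 0 < q.η` ADDED after `hη`, and
`g_q := (q.BΓ·q.cV)·(q.BΓ·(m·c₀(1,q.η)^{(𝓣 s₀).ν})) ∕ q.mA` displayed inside `hsmall` ∕ `hvol`.
[cite: Balaban1988RG2Cluster, Lemmas 1–3 pp.9, 11, 20; (1.11) p.5, p.13, p.15, (2.14)–(2.26) pp.15–17; Balaban1985BackgroundPropagators, Thm 3.10 p.416] -/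
theorem b13Leaf_twoTorus_uniformWalksAcross₃
    (c : B13.Consts) {S : Type*} (𝓣 : S → TorusTerms c 4) {q : WalkPackage} (hall : UniformWalksAcross 𝓣 q)
    (s₀ : S) [NeZero (𝓣 s₀).N'] (Wt : TwoTorusStep 4 L (𝓣 s₀).N') (k : ℕ) (hN12 : 12 ≤ L * (𝓣 s₀).N') (hL8 : 8 ≤ c.L) (hLc : c.L = L)
    -- (1) LEMMA 1: index data of (1.33)
    (S0 : TDom 4 (L * (𝓣 s₀).N') → Finset (TPt 4 (L * (𝓣 s₀).N')))
    (F : TDom 4 (L * (𝓣 s₀).N') → TPt 4 (L * (𝓣 s₀).N') → Finset (TPt 4 (L * (𝓣 s₀).N')))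
    (Sq : TDom 4 (L * (𝓣 s₀).N') → TPt 4 (L * (𝓣 s₀).N') → (j : ℕ) → Finset (TPt 4 (L ^ (k - j) * (L * (𝓣 s₀).N'))))
    (SX : TDom 4 (L * (𝓣 s₀).N') → TPt 4 (L * (𝓣 s₀).N') → (j : ℕ) → TPt 4 (L ^ (k - j) * (L * (𝓣 s₀).N')) →
      Finset (TDom 4 (L ^ (k - j) * (L * (𝓣 s₀).N'))))
    (T : TDom 4 (L * (𝓣 s₀).N') → TPt 4 (L * (𝓣 s₀).N') → Finset (TPt 4 (L * (𝓣 s₀).N')) → (j : ℕ) →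
      TPt 4 (L ^ (k - j) * (L * (𝓣 s₀).N')) → TDom 4 (L ^ (k - j) * (L * (𝓣 s₀).N')) → Wt.Φ → ℂ)
    (Sc : TDom 4 (L * (𝓣 s₀).N') → Finset (TPt 4 (L * (𝓣 s₀).N')))
    (Sq' : TDom 4 (L * (𝓣 s₀).N') → TPt 4 (L * (𝓣 s₀).N') → (j : ℕ) → Finset (TPt 4 (L ^ (k - j) * (L * (𝓣 s₀).N'))))
    (SX' : TDom 4 (L * (𝓣 s₀).N') → TPt 4 (L * (𝓣 s₀).N') → (j : ℕ) → TPt 4 (L ^ (k - j) * (L * (𝓣 s₀).N')) →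
      Finset (TDom 4 (L ^ (k - j) * (L * (𝓣 s₀).N'))))
    (T' : TDom 4 (L * (𝓣 s₀).N') → TPt 4 (L * (𝓣 s₀).N') → (j : ℕ) → TPt 4 (L ^ (k - j) * (L * (𝓣 s₀).N')) →
      TDom 4 (L ^ (k - j) * (L * (𝓣 s₀).N')) → Wt.Φ → ℂ)
    (dist : TDom 4 (L * (𝓣 s₀).N') → TPt 4 (L * (𝓣 s₀).N') → (j : ℕ) → TPt 4 (L ^ (k - j) * (L * (𝓣 s₀).N')) → ℝ) {K K' : ℝ}
    (h133 : ∀ Y, Wt.Vp Y =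
      (∑ a ∈ S0 Y, ∑ X ∈ (F Y a).powerset, ∑ j ∈ Finset.range (k + 1), ∑ q ∈ Sq Y a j,
        ∑ x ∈ SX Y a j q, T Y a X j q x) +
      (∑ a ∈ Sc Y, ∑ j ∈ Finset.range (k + 1), ∑ q ∈ Sq' Y a j, ∑ x ∈ SX' Y a j q, T' Y a j q x))
    (hS0Y : ∀ Y, ∀ a ∈ S0 Y,
      (pbox (fun i => natLift a i - (5 : ℕ)) (fun i => natLift a i + 1 + (5 : ℕ))).image (proj (L * (𝓣 s₀).N')) ⊆ Y.1)
    (hFsub : ∀ Y a, F Y a ⊆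
      (pbox (fun i => natLift a i - (5 : ℕ)) (fun i => natLift a i + 1 + (5 : ℕ))).image (proj (L * (𝓣 s₀).N')) \
        (pbox (fun i => natLift a i - (4 : ℕ)) (fun i => natLift a i + 1 + (4 : ℕ))).image (proj (L * (𝓣 s₀).N')))
    (hSq : ∀ Y, ∀ a ∈ S0 Y, ∀ j, Sq Y a j ⊆ (Finset.univ : Finset (TPt 4 (L ^ (k - j) * (L * (𝓣 s₀).N')))).filter
      (fun q => tcoarse (L ^ (k - j)) (L * (𝓣 s₀).N') q ∈
        (pbox (fun i => natLift a i - (2 : ℕ)) (fun i => natLift a i + 1 + (2 : ℕ))).image (proj (L * (𝓣 s₀).N'))))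
    (hScY : ∀ Y, Sc Y ⊆ Y.1)
    (hdist0 : ∀ Y a j q, 0 ≤ c.δ₀ * dist Y a j q)
    (hdist : ∀ Y a j (n : ℕ) q, q ∉ (pbox (fun i => ((L ^ (k - j) : ℕ) : ℤ) * natLift a i - (n + 1 : ℕ))
      (fun i => ((L ^ (k - j) : ℕ) : ℤ) * natLift a i + 2 * ((L ^ (k - j) : ℕ) : ℤ) - 1 + (n + 1 : ℕ))).image
        (proj (L ^ (k - j) * (L * (𝓣 s₀).N'))) → c.δ₀ * c.M * ((n : ℝ) + 1) ≤ c.δ₀ * dist Y a j q)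
    (hSX : ∀ Y a j q, SX Y a j q ⊆ (tcubeSys 4 (L ^ (k - j) * (L * (𝓣 s₀).N'))).above q)
    (hSX' : ∀ Y a j q, SX' Y a j q ⊆ (tcubeSys 4 (L ^ (k - j) * (L * (𝓣 s₀).N'))).above q)
    (hX0 : ∀ Y, ∀ a ∈ Sc Y, ∀ j ∈ Finset.range (k + 1), ∀ q ∈ Sq' Y a j, ∀ x ∈ SX' Y a j q,
      x.1.image (tcoarse (L ^ (k - j)) (L * (𝓣 s₀).N')) ⊆ Y.1)
    -- (1) LEMMA 1: analyticity of the terms, closure of `Analytic`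
    (hAdd : ∀ (s : Set Wt.Φ) (f g : Wt.Φ → ℂ), Wt.Analytic f s → Wt.Analytic g s → Wt.Analytic (f + g) s)
    (hZero : ∀ s : Set Wt.Φ, Wt.Analytic 0 s)
    (hAnT : ∀ Y, ∀ a ∈ S0 Y, ∀ X ∈ (F Y a).powerset, ∀ j ∈ Finset.range (k + 1), ∀ q ∈ Sq Y a j,
      ∀ x ∈ SX Y a j q, Wt.Analytic (T Y a X j q x) (Wt.sp1 Y))
    (hAnT' : ∀ Y, ∀ a ∈ Sc Y, ∀ j ∈ Finset.range (k + 1), ∀ q ∈ Sq' Y a j, ∀ x ∈ SX' Y a j q,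
      Wt.Analytic (T' Y a j q x) (Wt.sp1 Y))
    -- (1) LEMMA 1: thresholds and restrictions
    (hK : 0 ≤ K) (hK' : 0 ≤ K') (hκ : 0 ≤ c.κ) (hδ1 : c.δ < 1) (hδκ : 1 ≤ c.δ * c.κ)
    (hκ126 : kappa₀ 64 8 ≤ c.κ) (hκ126' : kappa₀ 64 8 ≤ c.δ * c.κ)
    (hκ₁ : 1 + 2 * Real.log (8 * 12 ^ 3) ≤ c.κ₁) (hκ₁' : 2 + 16 * Real.log 128 ≤ c.κ₁)
    (hδ₀M : 10 * Real.exp (-1) ≤ c.δ₀ * c.M) (hδ₀M5 : 2 * Real.log 5 ≤ c.δ₀ * c.M)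
    (hR8 : (1 - c.δ) * c.κ ≤ (1 / 4) * (c.κ₁ - 1)) (hR9 : (1 - 2 * c.δ) * c.κ ≤ (1 / 16) * c.κ₁)
    -- (1) LEMMA 1: per-term (1.24), (1.30) (IN-EDGES); the constants of (1.36) with headroom (1 − θ) for the local pieces
    (h124 : ∀ Y φ, φ ∈ Wt.sp1 Y → ∀ a ∈ S0 Y, ∀ X ∈ (F Y a).powerset, ∀ j ∈ Finset.range (k + 1), ∀ q ∈ Sq Y a j,
      ∀ x ∈ SX Y a j q,
        ‖T Y a X j q x φ‖ ≤ K * ((L : ℝ) ^ j * ((L : ℝ) ^ k)⁻¹) ^ 5 *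
          Real.exp (-(c.κ₁ - 1) *
            (((Y.1 \ (pbox (fun i => natLift a i - (5 : ℕ)) (fun i => natLift a i + 1 + (5 : ℕ))).image
              (proj (L * (𝓣 s₀).N'))).card : ℝ) + X.card)) *
          Real.exp (-(c.κ * torusTreeLen x.1)))
    (h130 : ∀ Y φ, φ ∈ Wt.sp1 Y → ∀ a ∈ Sc Y, ∀ j ∈ Finset.range (k + 1), ∀ q ∈ Sq' Y a j,
      ∀ x ∈ SX' Y a j q,
        ‖T' Y a j q x φ‖ ≤ K' * Real.exp (-(1 / 2) * (c.δ₀ * c.M) * ((L : ℝ) ^ j * ((L : ℝ) ^ k)⁻¹)⁻¹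
            - (1 / 2) * c.δ₀ * dist Y a j q) *
          Real.exp (-(c.κ₁ - 1) * ((Y.1 \ x.1.image (tcoarse (L ^ (k - j)) (L * (𝓣 s₀).N'))).card : ℝ)) *
          Real.exp (-(c.κ * torusTreeLen x.1)))
    {θ : ℝ} (hθ0 : 0 ≤ θ) (hθ1 : θ < 1)
    (hC : K * K₀ 64 8 * (2 * (6 * (L : ℝ)) ^ 4) * Real.exp 1 * Real.exp ((1 / 8) * c.κ₁ * (12 ^ 4 - 1)) +
        2 * (64 * K') * K₀ 64 8 * 1344 ≤
      (1 - θ) * (c.E₀ * c.ε₁ * c.C₁ * c.M ^ c.q * Real.exp (c.C₂ * c.κ₁)))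
    -- (2) LEMMA 2 (pp. 10–11): V″_k = V′_k + the local pieces G of P^{(k)}, analytic and (1.36)-small at prefactor θ
    (Gl : TDom 4 (L * (𝓣 s₀).N') → Wt.Φ → ℂ) (hVpp : ∀ Y, Wt.Vpp Y = fun φ => Wt.Vp Y φ + Gl Y φ)
    (hGlAn : ∀ Y, Wt.Analytic (Gl Y) (Wt.sp1 Y))
    (hGl : ∀ Y φ, φ ∈ Wt.sp1 Y → ‖Gl Y φ‖ ≤ θ * (c.E₀ * c.ε₁ * c.C₁ * c.M ^ c.q * Real.exp (c.C₂ * c.κ₁)) *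
      Real.exp (-((1 - 2 * c.δ) * c.κ * (tsys 4 (L * (𝓣 s₀).N')).dj Y)))
    -- (2) LEMMA 2: the located per-term data of `B13Lemma2Torus.lemma2Printed_twoTorus'`
    {E : Type*} [NormedAddCommGroup E] [NormedSpace ℂ E]
    (rd : TDom 4 (L * (𝓣 s₀).N') → Wt.Φ → E) (e : TDom 4 (L * (𝓣 s₀).N') → Wt.Bond → E) (he : ∀ Y b, ‖e Y b‖ ≤ 1)
    (hrd : ∀ Y φ, rd Y φ = haveI := Wt.finBond; ∑ b, Wt.Bv φ b • e Y b)
    {ι₂ : Type*} (s : TDom 4 (L * (𝓣 s₀).N') → Finset ι₂) (Wf : TDom 4 (L * (𝓣 s₀).N') → ι₂ → Wt.Φ → E → ℂ) {g : ℂ} (hg : g ≠ 0)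
    {R K₂ : ℝ} {m₂ : ℕ} (hK₂ : 0 ≤ K₂) (hR : 0 < R) (h3 : 3 * c.ε₁ ≤ R)
    (hW : ∀ Y, ∀ i ∈ s Y, ∀ φ ∈ Wt.sp1 Y, AnalyticOnNhd ℂ (Wf Y i φ) (ball 0 R))
    (hKW : ∀ Y, ∀ i ∈ s Y, ∀ φ ∈ Wt.sp1 Y, ∀ z ∈ ball (0 : E) R,
      ‖Wf Y i φ z‖ ≤ K₂ * Real.exp (-(c.κ₁ - 1) * ((Y.1.card : ℝ) - 1)) * ‖z‖ ^ 3)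
    (hcard : ∀ Y, (s Y).card ≤ m₂ * Y.1.card)
    (hV : ∀ Y, Wt.V Y = fun φ => (∑ i ∈ s Y, scaled g (Wf Y i φ) (rd Y φ)) + Wt.Vpp Y φ)
    (hQ : ∀ Y φ (b b' : Wt.Bond), φ ∈ Wt.sp1 Y →
      Wt.Q Y φ b b' = 2 * ∑ i ∈ s Y, Qop (scaled g (Wf Y i φ)) (rd Y φ) (e Y b) (e Y b'))
    (hsp : ∀ Y φ, φ ∈ Wt.sp1 Y → ‖g‖ * ‖rd Y φ‖ < c.ε₁)
    (hvolk : ∀ Y, Wt.volk Y = Y.1.card)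
    (hfloor : 27 * m₂ * K₂ * Real.exp (c.κ₁ - 1) ≤ c.C₃ * c.M ^ 4 * Real.exp (c.C₂ * c.κ₁))
    (hAnP : ∀ Y, ∀ i ∈ s Y, Wt.Analytic (fun φ => scaled g (Wf Y i φ) (rd Y φ)) (Wt.sp1 Y))
    (hG : ∀ Y, Wt.GaugeInv (Wt.V Y) ∧ Wt.GaugeInv (Wt.toStepData.quadForm Y) ∧ Wt.GaugeInv (Wt.Vpp Y))
    -- (3) LEMMA 3 (pp. 14–20): the signs of (2.18)–(2.20), R12, |τ(Y)| ≥ 2, and the numerics bundle at ℓ = ½L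
    (M₃ : ℕ) [NeZero M₃] {a a₂ a₂' a₅ Aabs : ℝ} (hN : Lemma3Numerics c M₃ ((c.L : ℝ) / 2) a a₂ a₂' a₅ Aabs)
    (h12 : R12 c) (hE : 0 < c.E₀) (hε : 0 < c.ε₁) (hC₁ : 0 < c.C₁) (hα : 0 < c.α₄) (hM : 1 ≤ c.M)
    (hτ2 : c.E₀ * c.ε₁ * c.C₁ * c.α₄⁻¹ * c.M ^ c.q * Real.exp (c.C₂ * c.κ₁) ≤ 1 / 2)
    -- (3) the Cauchy radius and the parameter domains (p. 15)
    {Uσ Uτ : Set ℂ} (hUσ : IsOpen Uσ) (hUτ : IsOpen Uτ) (hUexp : Metric.closedBall (0 : ℂ) (Real.exp c.κ₁) ⊆ Uσ)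
    (hUtau : ∀ Y : TDom 4 (L * (𝓣 s₀).N'),
      Metric.closedBall (0 : ℂ) ((invTau c ((tsys 4 (L * (𝓣 s₀).N')).dj Y))⁻¹) ⊆ Uτ)
    {r : ℝ} (hr : 0 < r) (hr' : r ≤ Real.exp c.κ₁ - 1)
    (hsubτ : ∀ x ∈ Set.uIcc (0 : ℝ) 1, Metric.closedBall (x : ℂ) r ⊆ Uτ)
    -- (3) THE DICTIONARY: the (2.14)-term (𝐃, P) = t of Z ∈ 𝐃_{k+1} is the term `idx Z t` of the member `s₀` (its
    --     extra columns finite), read at the configuration `u = uOf Z t φ ∈ (𝓣 s₀).E` of `φ ∈ sp2 Z`, of size ≤ α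
    (idx : TDom 4 (𝓣 s₀).N' → Finset (TDom 4 (L * (𝓣 s₀).N')) × Finset (TBond 4 M₃ (L * (𝓣 s₀).N')) → (𝓣 s₀).ι)
    [∀ Z t, Fintype ((𝓣 s₀).𝒦 (idx Z t)).C₀] [∀ Z t, DecidableEq ((𝓣 s₀).𝒦 (idx Z t)).C₀]
    (uOf : (Z : TDom 4 (𝓣 s₀).N') → (t : Finset (TDom 4 (L * (𝓣 s₀).N')) × Finset (TBond 4 M₃ (L * (𝓣 s₀).N'))) →
      Wt.Φ → (𝓣 s₀).E)
    {α : ℝ} (hαnn : 0 ≤ α) (huα : ∀ Z, ∀ t ∈ terms L M₃ Z, ∀ φ ∈ Wt.sp2 Z, ‖uOf Z t φ‖ ≤ α)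
    -- (3) per term: parameter lists, the linear map Γ(σ), characteristic functions, potentials
    (lZ : TDom 4 (𝓣 s₀).N' → Finset (TDom 4 (L * (𝓣 s₀).N')) × Finset (TBond 4 M₃ (L * (𝓣 s₀).N')) →
      List (TPt 4 (𝓣 s₀).N'))
    (hlZ : ∀ Z, ∀ t ∈ terms L M₃ Z, (lZ Z t).Nodup ∧ (lZ Z t).toFinset = Z.1 \ tclosure L (𝓣 s₀).N' (Z0 M₃ t))
    (lD : TDom 4 (𝓣 s₀).N' → Finset (TDom 4 (L * (𝓣 s₀).N')) × Finset (TBond 4 M₃ (L * (𝓣 s₀).N')) →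
      List (TDom 4 (L * (𝓣 s₀).N')))
    (hlD : ∀ Z, ∀ t ∈ terms L M₃ Z, (lD Z t).Nodup ∧ (lD Z t).toFinset = t.1)
    (Γm : (Z : TDom 4 (𝓣 s₀).N') → (t : Finset (TDom 4 (L * (𝓣 s₀).N')) × Finset (TBond 4 M₃ (L * (𝓣 s₀).N'))) → Wt.Φ →
      (TPt 4 (𝓣 s₀).N' → ℂ) → (((𝓣 s₀).𝒦 (idx Z t)).Λ ⊕ ((𝓣 s₀).𝒦 (idx Z t)).C₀ → ℝ) → (((𝓣 s₀).𝒦 (idx Z t)).Λ → ℂ))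
    (χY₀ χcP : (Z : TDom 4 (𝓣 s₀).N') → (t : Finset (TDom 4 (L * (𝓣 s₀).N')) × Finset (TBond 4 M₃ (L * (𝓣 s₀).N'))) →
      (((𝓣 s₀).𝒦 (idx Z t)).Λ → ℝ) → ℝ)
    (hχ0 : ∀ Z t B, 0 ≤ χY₀ Z t B) (hχ1 : ∀ Z t B, χY₀ Z t B ≤ 1)
    (Pl : (Z : TDom 4 (𝓣 s₀).N') → (t : Finset (TDom 4 (L * (𝓣 s₀).N')) × Finset (TBond 4 M₃ (L * (𝓣 s₀).N'))) → Finset ((𝓣 s₀).𝒦 (idx Z t)).Λ)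
    (hPcard : ∀ Z, ∀ t ∈ terms L M₃ Z, (Pl Z t).card = t.2.card) {rP : ℝ} (hrP : 0 ≤ rP)
    (hχc : ∀ Z t B, χcP Z t B = ∏ b ∈ Pl Z t, (if rP ≤ |B b| then (1 : ℝ) else 0))
    (Dfam : TDom 4 (𝓣 s₀).N' → Finset (TDom 4 (L * (𝓣 s₀).N')) × Finset (TBond 4 M₃ (L * (𝓣 s₀).N')) → Finset (TDom 4 (L * (𝓣 s₀).N')))
    (Vr : (Z : TDom 4 (𝓣 s₀).N') → (t : Finset (TDom 4 (L * (𝓣 s₀).N')) × Finset (TBond 4 M₃ (L * (𝓣 s₀).N'))) → Wt.Φ →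
      TDom 4 (L * (𝓣 s₀).N') → (((𝓣 s₀).𝒦 (idx Z t)).Λ → ℝ) → ℂ)
    -- (3) termwise domination: ‖H(Z)‖ ≤ Σ_{(𝐃,P)} ‖(2.14)‖ on the space of p. 15 ((2.9)/(2.14))
    (hH : ∀ (Z : TDom 4 (𝓣 s₀).N') (φ : Wt.Φ), φ ∈ Wt.sp2 Z → ‖Wt.H Z φ‖ ≤
      ∑ t ∈ terms L M₃ Z, ‖term214 r (lZ Z t) (lD Z t)
        (core214 (fun σ => ((𝓣 s₀).𝒦 (idx Z t)).A2 σ (uOf Z t φ)) (Γm Z t φ)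
          (F214 t.2.card (χY₀ Z t) (χcP Z t) (Dfam Z t) (Vr Z t φ))) 0 0‖)
    -- (3) the record's objects behind the terms: bonds, cubes, the real field inside the configurations
    (ιb : (Z : TDom 4 (𝓣 s₀).N') → (t : Finset (TDom 4 (L * (𝓣 s₀).N')) × Finset (TBond 4 M₃ (L * (𝓣 s₀).N'))) → ((𝓣 s₀).𝒦 (idx Z t)).Λ → Wt.Bond)
    (hι : ∀ Z t, Function.Injective (ιb Z t)) (cube : Wt.Bond → TPt 4 (L * (𝓣 s₀).N'))
    (hQsupp : ∀ (Y : TDom 4 (L * (𝓣 s₀).N')) φ b b', Wt.Q Y φ b b' ≠ 0 → cube b ∈ Y.1 ∧ cube b' ∈ Y.1)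
    {m' : ℕ} (hfibc : ∀ Z t (x : TPt 4 (L * (𝓣 s₀).N')), (Finset.univ.filter fun j => cube (ιb Z t j) = x).card ≤ m')
    (emb : (Z : TDom 4 (𝓣 s₀).N') → (t : Finset (TDom 4 (L * (𝓣 s₀).N')) × Finset (TBond 4 M₃ (L * (𝓣 s₀).N'))) → Wt.Φ →
      (((𝓣 s₀).𝒦 (idx Z t)).Λ → ℝ) → Wt.Φ)
    (hBv : ∀ Z t φ B b, Wt.Bv (emb Z t φ B) (ιb Z t b) = (B b : ℂ))
    (hBv0 : ∀ Z t φ B b', b' ∉ Set.range (ιb Z t) → Wt.Bv (emb Z t φ B) b' = 0)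
    (hVr : ∀ Z, ∀ t ∈ terms L M₃ Z, ∀ φ ∈ Wt.sp2 Z, ∀ Y ∈ Dfam Z t, ∀ B,
      emb Z t φ B ∈ Wt.sp1 Y → Vr Z t φ Y B = Wt.V Y (emb Z t φ B))
    (hχsupp : ∀ Z, ∀ t ∈ terms L M₃ Z, ∀ φ ∈ Wt.sp2 Z, ∀ B, χY₀ Z t B ≠ 0 → ∀ Y ∈ Dfam Z t,
      emb Z t φ B ∈ Wt.sp1 Y)
    -- (3) separate holomorphy of the X-integral in (σ, τ)
    (hΨσ : ∀ Z, ∀ t ∈ terms L M₃ Z, ∀ φ ∈ Wt.sp2 Z, ∀ τ : TDom 4 (L * (𝓣 s₀).N') → ℂ, (∀ j, τ j ∈ Uτ) →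
      SepHolOn Uσ (fun σ => core214 (fun σ => ((𝓣 s₀).𝒦 (idx Z t)).A2 σ (uOf Z t φ)) (Γm Z t φ)
        (F214 t.2.card (χY₀ Z t) (χcP Z t) (Dfam Z t) (Vr Z t φ)) σ τ))
    (hΨτ : ∀ Z, ∀ t ∈ terms L M₃ Z, ∀ φ ∈ Wt.sp2 Z, ∀ σ : TPt 4 (𝓣 s₀).N' → ℂ, (∀ j, σ j ∈ Uσ) →
      SepHolOn Uτ (fun τ => core214 (fun σ => ((𝓣 s₀).𝒦 (idx Z t)).A2 σ (uOf Z t φ)) (Γm Z t φ)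
        (F214 t.2.card (χY₀ Z t) (χcP Z t) (Dfam Z t) (Vr Z t φ)) σ τ))
    -- (3) NODE A's structural inputs at the configuration: A(σ) COMPLEX SYMMETRIC on the polydisc; Γ(σ) = G(σ)·
    (hAs : ∀ Z, ∀ t ∈ terms L M₃ Z, ∀ φ ∈ Wt.sp2 Z, ∀ σ : TPt 4 (𝓣 s₀).N' → ℂ, (∀ j, ‖σ j‖ ≤ Real.exp c.κ₁) →
      (((𝓣 s₀).𝒦 (idx Z t)).A2 σ (uOf Z t φ)).IsSymm)
    (hlin : ∀ Z, ∀ t ∈ terms L M₃ Z, ∀ φ ∈ Wt.sp2 Z, ∀ σ : TPt 4 (𝓣 s₀).N' → ℂ, (∀ j, ‖σ j‖ ≤ Real.exp c.κ₁) →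
      ∀ X : ((𝓣 s₀).𝒦 (idx Z t)).Λ ⊕ ((𝓣 s₀).𝒦 (idx Z t)).C₀ → ℝ, Γm Z t φ σ X = ((𝓣 s₀).𝒦 (idx Z t)).G2 σ (uOf Z t φ) *ᵥ fun j => (X j : ℂ))
    {γ₂ : ℝ} (hγ₂ : 0 ≤ γ₂)
    -- (3) uniform fibre bounds of the bond locations
    {m : ℕ}
    (hfibΛ : ∀ Z t (x : UT (𝓣 s₀).Nf), (Finset.univ.filter fun i => ((𝓣 s₀).𝒦 (idx Z t)).locΛ i = x).card ≤ m)
    (hfibN : ∀ Z t (x : UT (𝓣 s₀).Nf), (Finset.univ.filter fun j => ((𝓣 s₀).𝒦 (idx Z t)).locN j = x).card ≤ m)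
    -- (3) THE RUNG's PACKAGE: admissible with positive rates, `η ≤ etaMax` (standard rate book, `κ_C = q.kapCStar`,
    --     `ρ′ = q.mu/4`), `α < R`, round letters, and PRINT's TWO THRESHOLDS for a `θ₀ > 0`
    (hq : q.Admissible) (hp : q.PositiveRates) (hη : q.η ≤ q.etaMax) (hη0 : 0 < q.η) (hαR : α < q.R)
    {KG KCs θ₀ : ℝ} (hKG : q.Kbar ≤ KG) (hKCs : 4 / q.mA ≤ KCs) (hθ₀ : 0 < θ₀)
    (hαsmall : α ≤ θ₀ * q.R / (4 * q.Kbar + 4))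
    (hRσlarge : Real.log ((4 * q.Kbar + 4) / θ₀) / (q.mu / 4 - q.kapCStar) ≤ q.Rσ)
    -- (3) rates below the rung's κ_C⋆, and NODE A's letter ϑ (θ_Γ = θ_E = θ₀, K_Γ = K_G, K₀′ = K_Cs, θ_C derived)
    {kap kap' kap'' kap₂ ϑ : ℝ} (hkap'' : 0 < kap'') (hk1 : kap'' < kap') (hk2 : kap' < kap) (hk3 : kap < kap₂)
    (hk4 : kap₂ < q.kapCStar) (hθ₀le : θ₀ ≤ ϑ)
    (hθR1le : (m * (1 + 2 / (kap - kap')) ^ (𝓣 s₀).ν) * (m * (1 + 2 / (kap' - kap'')) ^ (𝓣 s₀).ν)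
      * (θ₀ * KCs * KG
        + KG * (KCs * θ₀ * (m * (1 + 2 / (q.kapCStar - kap₂)) ^ (𝓣 s₀).ν) * KCs
          * (m * (1 + 2 / (kap₂ - kap)) ^ (𝓣 s₀).ν)) * KG
        + KG * KCs * θ₀) ≤ ϑ)
    (hsmallKθ : KCs * (m * (1 + 2 / kap) ^ (𝓣 s₀).ν) * (ϑ * (m * (1 + 2 / kap'') ^ (𝓣 s₀).ν)) < 1)
    -- (3) the (2.24)–(2.25) smallness with `a₂₀ = m′·α₄·M⁻⁴(1 + 32/(κ₁−1))⁴`; `1∕m_A ≤ cE`; the form bound of Γ₀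
    {cE : ℝ} (hc0 : 0 ≤ cE)
    (hcE : 1 / q.mA ≤ cE)
    (hαc : (2 * (ϑ * (m * (1 + 2 / kap'') ^ (𝓣 s₀).ν)) +
      (γ₂ + m' * c.α₄ * (c.M ^ 4)⁻¹ * (1 + 32 / (c.κ₁ - 1)) ^ 4)) * cE ≤ 1 / 2)
    (hsmall : (2 * (ϑ * (m * (1 + 2 / kap'') ^ (𝓣 s₀).ν)) +
      (γ₂ + m' * c.α₄ * (c.M ^ 4)⁻¹ * (1 + 32 / (c.κ₁ - 1)) ^ 4)) * (1 + 2 * cE * ((q.BΓ * q.cV) * (q.BΓ * (m * B6.c0 1 q.η ^ (𝓣 s₀).ν)) / q.mA)) ≤ 1 / 2)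
    -- (3) constant matching, p. 17: `a ≤ γ₂ r_P²` and the volume factor with `w = K₀(64,8)·α₄·#(⋃𝐃)`
    (hPa : a ≤ γ₂ * rP ^ 2)
    (hvol : ∀ Z, ∀ t ∈ terms L M₃ Z,
      2 * (KCs * (m * (1 + 2 / kap) ^ (𝓣 s₀).ν) * (ϑ * (m * (1 + 2 / kap'') ^ (𝓣 s₀).ν))
              * (1 + (1 - KCs * (m * (1 + 2 / kap) ^ (𝓣 s₀).ν) * (ϑ * (m * (1 + 2 / kap'') ^ (𝓣 s₀).ν)))⁻¹) / 2)
          * (Fintype.card ((𝓣 s₀).𝒦 (idx Z t)).Λ : ℝ)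
        + K₀ 64 8 * c.α₄ * ((((Dfam Z t).image Subtype.val).biUnion id).card : ℝ)
        + (2 * (ϑ * (m * (1 + 2 / kap'') ^ (𝓣 s₀).ν)) +
            (γ₂ + m' * c.α₄ * (c.M ^ 4)⁻¹ * (1 + 32 / (c.κ₁ - 1)) ^ 4)) * cE * (Fintype.card ((𝓣 s₀).𝒦 (idx Z t)).Λ : ℝ)
        + (2 * (ϑ * (m * (1 + 2 / kap'') ^ (𝓣 s₀).ν)) +
            (γ₂ + m' * c.α₄ * (c.M ^ 4)⁻¹ * (1 + 32 / (c.κ₁ - 1)) ^ 4)) * (1 + 2 * cE * ((q.BΓ * q.cV) * (q.BΓ * (m * B6.c0 1 q.η ^ (𝓣 s₀).ν)) / q.mA))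
            * (Fintype.card (((𝓣 s₀).𝒦 (idx Z t)).Λ ⊕ ((𝓣 s₀).𝒦 (idx Z t)).C₀) : ℝ)
        ≤ a₅ * ((Z.1).card : ℝ)) :
    B13.Lemma1Printed Wt.toStepData c ∧ B13.Lemma2Printed Wt.toStepData c ∧ B13.Lemma3Printed Wt.toStepData c :=
  b13Leaf_twoTorus_uniformWalksAcross₂ c 𝓣 hall s₀ Wt k hN12 hL8 hLc S0 F Sq SX T Sc Sq' SX' T' dist h133 hS0Y hFsub
    hSq hScY hdist0 hdist hSX hSX' hX0 hAdd hZero hAnT hAnT' hK hK' hκ hδ1 hδκ hκ126 hκ126' hκ₁ hκ₁' hδ₀M hδ₀M5 hR8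
    hR9 h124 h130 hθ0 hθ1 hC Gl hVpp hGlAn hGl rd e he hrd s Wf hg hK₂ hR h3 hW hKW hcard hV hQ hsp hvolk hfloor hAnP
    hG M₃ hN h12 hE hε hC₁ hα hM hτ2 hUσ hUτ hUexp hUtau hr hr' hsubτ idx uOf hαnn huα lZ hlZ lD hlD Γm χY₀ χcP hχ0
    hχ1 Pl hPcard hrP hχc Dfam Vr hH ιb hι cube hQsupp hfibc emb hBv hBv0 hVr hχsupp hΨσ hΨτ hAs hlin hγ₂ hfibΛ hfibN
    hq hp hη hαR hKG hKCs hθ₀ hαsmall hRσlarge hkap'' hk1 hk2 hk3 hk4 hθ₀le hθR1le hsmallKθ hc0 hcE hαc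
    (div_nonneg (mul_nonneg (mul_nonneg (WalkPackage.BΓ_nonneg hq) hq.hcV)
      (mul_nonneg (WalkPackage.BΓ_nonneg hq)
        (mul_nonneg (Nat.cast_nonneg m) (pow_nonneg (RefPackage.c0_nonneg hη0) (𝓣 s₀).ν)))) hq.hmA.le)
    (fun Z t _ X => gammaForm_le_of_termWalks hq hp hη hη0 (termWalks_of_uniformWalksAcross hall s₀ (idx Z t)) (hfibΛ Z t)
      le_rfl X)
    hsmall hPa hvol

end Across

end Literature.MathematicalPhysics.QuantumFieldTheory.Balaban1983to89.B13NodeTorusWalksGammaLeaves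

end
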